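import Summits.Langlands.Langlands.Theorems.DyadicOddResidueDyadicEisensteinFMStubCmTateTwistNewform
import Summits.Langlands.Langlands.Theorems.IrreducibilityBySelfDualityReciprocityUpToIrreducibilityHeckeParallelNormTwist
import HarnessLib

/-!
# Stub A′ `stub_cmTateTwistNewform` of the crux `DyadicOddResidue.DyadicEisensteinFM` (stmt-Langlands-18741):
# the glue hypothesis G discharged — A′ closed modulo the Literature facts F2′, F2, H, F3 only

Line `ordinary-seed-propagation`, stub A′, wave 3.  The landed reduction
`cmTateTwistNewform_of_facts : F2′ → F2 → H → F3 → G → <A′ verbatim>`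
(`…StubCmTateTwistNewform`) carried ONE tree-side glue hypothesis G (its fifth binder): for a
quadratic field `K` which is not totally real and an algebraic Hecke character `χ` of `K` of infinity
type `(p, q)` with two distinct embedding exponents, there are `k ≥ 2`, `m ∈ ℤ` and a Hecke character
`ψ` of infinity type `(k - 1, 0)` or `(0, k - 1)`, unramified exactly where `χ` is, with
`ψ(ϖ_w) = χ(ϖ_w)⁻¹ · (N w)^m` at every finite place `w`.  This file PROVES G
(`exists_normTwist_inv_hasInfinityType_of_embExponent_ne`) from the tree's Hecke-character API and
concludes `cmTateTwistNewform_of_literatureFacts : F2′ → F2 → H → F3 → <A′ verbatim>`.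

Proof of G (bookkeeping, Weil 1956 §1): `K` has `r₁ + 2 r₂ = 2` with `r₂ ≠ 0`, so `r₁ = 0`, `r₂ = 1`:
`K` is totally complex with a single infinite place `w₀`, the embeddings are `σ = σ_{w₀}` and `σ̄ ≠ σ`
with exponents `a = p_{w₀}` and `b = q_{w₀}`, hence `a ≠ b`.  Put `m = max(a, b)`, `k = |a - b| + 1 ≥ 2`
and `ψ = χ⁻¹ · ‖·‖^{-m}`.  Infinity types add under products and scale under integer powers
(`hasInfinityType_mul`, `hasInfinityType_zpow`, wave N11-B of `ReciprocityUpToIrreducibility`), and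
`‖·‖` has type `(-1, -1)` at the complex place (`hasInfinityType_normCharacter`), so `ψ` has type
`(m - a, m - b) ∈ {(k-1, 0), (0, k-1)}`; `‖·‖` is unramified everywhere with `‖ϖ_w‖ = (N w)⁻¹`
(`HeckeCharacter.isUnramifiedAt_normCharacter`, `valueAtUniformizer_normCharacter`), so `ψ` is
unramified exactly where `χ` is and `ψ(ϖ_w) = χ(ϖ_w)⁻¹ (N w)^m`.

No definitions; standard axioms; no new named fact.  A′ now waits only on the Literature facts
F2′ `Literature.NumberTheory.PAdicHodge.isDeRhamFramed_of_isDeRhamFramed_induce`,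
F2 `Literature.NumberTheory.GaloisRepresentations.FramedGaloisRep.exists_heckeCharacter_of_isDeRhamFramed`,
H `Literature.NumberTheory.PAdicHodge.labelledHodgeTateWeightsAt_induce_of_parallel`,
F3 `Literature.NumberTheory.EllipticCurves.ModularForms.Ribet1977_cmNewform_of_heckeCharacter`.
-/

set_option linter.dupNamespace false -- project-wide option; `Summit.Langlands.Langlands` is the mandated namespace

noncomputable section

open scoped NumberField Classical
open NumberField IsDedekindDomain Filter NumberField.InfinitePlace
open Literature.NumberTheory.GaloisRepresentations
open Summit.Langlands.Langlands.Theorems.ReciprocityUpToIrreducibility (hasInfinityType_mul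
  hasInfinityType_zpow hasInfinityType_congr_of_isReal hasInfinityType_normCharacter)

namespace Summit.Langlands.Langlands.Theorems.DyadicEisensteinFM

/-! ## 1. Norm twists of the inverse character: ramification and values at uniformizers -/

section HeckeTwist

variable {K : Type} [Field K] [NumberField K]

/-- `(χ^k)(x) = χ(x)^k` for `k ∈ ℤ` (integer powers of Hecke characters are pointwise). [folklore] -/
private theorem heckeCharacter_zpow_apply' (χ : HeckeCharacter K) (k : ℤ) (x : ideleGroup K) :
    (χ ^ k) x = χ x ^ k := by
  obtain ⟨n, rfl | rfl⟩ := k.eq_nat_or_neg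
  · rw [zpow_natCast, zpow_natCast, HeckeCharacter.pow_apply]
  · rw [zpow_neg, zpow_neg, zpow_natCast, zpow_natCast, HeckeCharacter.inv_apply,
      HeckeCharacter.pow_apply]

/-- **`χ⁻¹ · ‖·‖^m` is unramified exactly where `χ` is**: the norm character is unramified at every
finite place (`HeckeCharacter.isUnramifiedAt_normCharacter`: the idele norm kills `𝒪_vˣ`) and local
components are multiplicative. [cite: TateThesis1967, §2.3 and Lemma 2.3.1] -/
theorem isUnramifiedAt_inv_mul_normCharacter_zpow_iff (χ : HeckeCharacter K) (m : ℤ)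
    (v : HeightOneSpectrum (𝓞 K)) :
    (χ⁻¹ * HeckeCharacter.normCharacter K ^ m).IsUnramifiedAt v ↔ χ.IsUnramifiedAt v := by
  refine forall_congr' fun u => ?_
  have h2 := HeckeCharacter.isUnramifiedAt_normCharacter v u
  rw [HeckeCharacter.localComponent_apply] at h2
  rw [HeckeCharacter.localComponent_apply, HeckeCharacter.localComponent_apply,
    HeckeCharacter.mul_apply, heckeCharacter_zpow_apply', h2, one_zpow, mul_one,
    HeckeCharacter.inv_apply, inv_eq_one]

/-- **The value of `χ⁻¹ · ‖·‖^{-m}` at a uniformizer**: `(χ⁻¹ ‖·‖^{-m})(ϖ_v) = χ(ϖ_v)⁻¹ · (N v)^m`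
(`‖ϖ_v‖ = (N v)⁻¹`, `HeckeCharacter.valueAtUniformizer_normCharacter`). [cite: TateThesis1967, §2.5 and §4.3] -/
theorem valueAtUniformizer_inv_mul_normCharacter_zpow (χ : HeckeCharacter K) (m : ℤ)
    (v : HeightOneSpectrum (𝓞 K)) :
    (χ⁻¹ * HeckeCharacter.normCharacter K ^ (-m)).valueAtUniformizer v =
      (χ.valueAtUniformizer v)⁻¹ * (v.residueCard : ℂ) ^ m := by
  have hN := HeckeCharacter.valueAtUniformizer_normCharacter (K := K) v
  simp only [HeckeCharacter.valueAtUniformizer, HeckeCharacter.localComponent_apply] at hN ⊢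
  rw [HeckeCharacter.mul_apply, Units.val_mul, heckeCharacter_zpow_apply',
    Units.val_zpow_eq_zpow_val, hN, HeckeCharacter.inv_apply, Units.val_inv_eq_inv_val, inv_zpow',
    neg_neg]

/-- **The infinity type of `χ⁻¹ · ‖·‖^{-m}`**: if `χ` has type `(p, q)` then `χ⁻¹ ‖·‖^{-m}` has type
`(m - p_w ; -q_w at real w / m - q_w at complex w)` (types add under products and scale under integer
powers, `‖·‖` has type `(-1; 0 / -1)`).  Weil 1956, §1. [cite: Weil1956, §1] -/
theorem hasInfinityType_inv_mul_normCharacter_zpow {χ : HeckeCharacter K}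
    {p q : InfinitePlace K → ℤ} (h : χ.HasInfinityType p q) (m : ℤ) :
    (χ⁻¹ * HeckeCharacter.normCharacter K ^ (-m)).HasInfinityType
      ((fun w => -1 * p w) + fun _ => -m * -1)
      ((fun w => -1 * q w) + fun w => -m * if w.IsReal then 0 else -1) := by
  have h1 := hasInfinityType_zpow h (-1)
  rw [zpow_neg_one] at h1
  exact hasInfinityType_mul h1 (hasInfinityType_zpow (hasInfinityType_normCharacter K) (-m))

end HeckeTwist

/-! ## 2. The glue G: normalising an algebraic Hecke character of an imaginary quadratic field -/

/-- **Glue G (the fifth hypothesis of `cmTateTwistNewform_of_facts`), proved.**  For `K` quadratic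
and not totally real and `χ` a Hecke character of `K` of infinity type `(p, q)` with two distinct
embedding exponents, there are `k ≥ 2`, `m ∈ ℤ` and `ψ` (namely `ψ = χ⁻¹ ‖·‖^{-m}`, `m = max(a, b)`,
`k = |a - b| + 1` for the exponents `a = p_{w₀}`, `b = q_{w₀}` at the unique, complex, infinite place
`w₀`) with `ψ` of infinity type `(k-1, 0)` or `(0, k-1)`, `ψ` unramified exactly where `χ` is, and
`ψ(ϖ_w) = χ(ϖ_w)⁻¹ (N w)^m`.  Bookkeeping over Weil 1956, §1 (types of products, powers and of the
norm); `r₁ + 2 r₂ = 2` with `r₂ ≠ 0` forces `r₁ = 0`, `r₂ = 1`. [cite: Weil1956, §1] -/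
theorem exists_normTwist_inv_hasInfinityType_of_embExponent_ne :
    ∀ (K : Type) [Field K] [NumberField K], Module.finrank ℚ K = 2 → ¬ NumberField.IsTotallyReal K →
      ∀ (χ : HeckeCharacter K) (p q : InfinitePlace K → ℤ), χ.HasInfinityType p q →
      (∃ φ φ' : K →+* ℂ, HeckeCharacter.embExponent p q φ ≠ HeckeCharacter.embExponent p q φ') →
      ∃ (k : ℕ) (m : ℤ) (ψ : HeckeCharacter K), 2 ≤ k ∧
        (ψ.HasInfinityType (fun _ => (k : ℤ) - 1) (fun _ => 0) ∨
          ψ.HasInfinityType (fun _ => 0) (fun _ => (k : ℤ) - 1)) ∧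
        (∀ w : HeightOneSpectrum (𝓞 K), ψ.IsUnramifiedAt w ↔ χ.IsUnramifiedAt w) ∧
        ∀ w : HeightOneSpectrum (𝓞 K),
          ψ.valueAtUniformizer w = (χ.valueAtUniformizer w)⁻¹ * (w.residueCard : ℂ) ^ m := by
  intro K _ _ hK2 hKr χ p q hpq hne
  -- `r₁ = 0`, `r₂ = 1`: `K` is totally complex with a single infinite place
  have hcx : nrComplexPlaces K ≠ 0 := fun h => hKr (NumberField.nrComplexPlaces_eq_zero_iff.mp h)
  have hrk := NumberField.InfinitePlace.card_add_two_mul_card_eq_rank K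
  rw [hK2] at hrk
  have h0 : nrRealPlaces K = 0 := by omega
  have h1 : nrComplexPlaces K = 1 := by omega
  haveI : IsTotallyComplex K := NumberField.nrRealPlaces_eq_zero_iff.mp h0
  haveI : Subsingleton (InfinitePlace K) := by
    have hc := NumberField.InfinitePlace.card_eq_nrRealPlaces_add_nrComplexPlaces (K := K)
    rw [h0, h1] at hc
    exact Fintype.card_le_one_iff_subsingleton.mp hc.le
  have hnoReal : ∀ w : InfinitePlace K, ¬ w.IsReal := fun w =>
    not_isReal_iff_isComplex.mpr (IsTotallyComplex.isComplex w)
  obtain ⟨φ₁, φ₂, hne⟩ := hne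
  set w₀ : InfinitePlace K := InfinitePlace.mk φ₁ with hw₀
  -- the two exponents `a = p w₀`, `b = q w₀` are distinct
  have hab : p w₀ ≠ q w₀ := by
    intro hpq'
    apply hne
    have key : ∀ φ : K →+* ℂ, HeckeCharacter.embExponent p q φ = p w₀ := fun φ => by
      unfold HeckeCharacter.embExponent
      rw [if_neg (IsTotallyComplex.complexEmbedding_not_isReal φ),
        Subsingleton.elim (InfinitePlace.mk φ) w₀, ← hpq', ite_self]
    rw [key, key]
  -- the twist
  have hunr : ∀ (m : ℤ) (w : HeightOneSpectrum (𝓞 K)),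
      (χ⁻¹ * HeckeCharacter.normCharacter K ^ (-m)).IsUnramifiedAt w ↔ χ.IsUnramifiedAt w :=
    fun m w => isUnramifiedAt_inv_mul_normCharacter_zpow_iff χ (-m) w
  rcases lt_or_gt_of_ne hab with hlt | hlt
  · -- `a < b`: `m = b`, `k - 1 = b - a`, type `(k - 1, 0)`
    obtain ⟨k, hk⟩ := Int.eq_ofNat_of_zero_le (show (0 : ℤ) ≤ q w₀ - p w₀ + 1 by omega)
    refine ⟨k, q w₀, χ⁻¹ * HeckeCharacter.normCharacter K ^ (-q w₀), by omega, Or.inl ?_,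
      hunr (q w₀), valueAtUniformizer_inv_mul_normCharacter_zpow χ (q w₀)⟩
    refine hasInfinityType_congr_of_isReal (hasInfinityType_inv_mul_normCharacter_zpow hpq (q w₀))
      (fun w hw => absurd hw (hnoReal w)) (fun w _ => ?_) (fun w hw => ?_)
    · rw [Subsingleton.elim w w₀, Pi.add_apply]
      omega
    · rw [Subsingleton.elim w w₀, Pi.add_apply, if_neg (hnoReal w₀)]
      omega
  · -- `b < a`: `m = a`, `k - 1 = a - b`, type `(0, k - 1)`
    obtain ⟨k, hk⟩ := Int.eq_ofNat_of_zero_le (show (0 : ℤ) ≤ p w₀ - q w₀ + 1 by omega)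
    refine ⟨k, p w₀, χ⁻¹ * HeckeCharacter.normCharacter K ^ (-p w₀), by omega, Or.inr ?_,
      hunr (p w₀), valueAtUniformizer_inv_mul_normCharacter_zpow χ (p w₀)⟩
    refine hasInfinityType_congr_of_isReal (hasInfinityType_inv_mul_normCharacter_zpow hpq (p w₀))
      (fun w hw => absurd hw (hnoReal w)) (fun w _ => ?_) (fun w hw => ?_)
    · rw [Subsingleton.elim w w₀, Pi.add_apply]
      omega
    · rw [Subsingleton.elim w w₀, Pi.add_apply, if_neg (hnoReal w₀)]
      omega

/-! ## 3. Stub A′ modulo the Literature facts only -/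

/-- **Stub A′ modulo the named printed facts F2′, F2, H, F3 (glue G discharged).**  Granting F2′
(`isDeRhamFramed_of_isDeRhamFramed_induce`, Patrikis 2019 Lemma 7.2.1), F2
(`FramedGaloisRep.exists_heckeCharacter_of_isDeRhamFramed`, Serre 1968 Ch. III / Patrikis Prop. 2.2.1), H
(`labelledHodgeTateWeightsAt_induce_of_parallel`, Patrikis 2019 Cor. 2.2.3) and F3
(`Ribet1977_cmNewform_of_heckeCharacter`, Ribet 1977 Thm. (3.4), Cor. (3.5)), stub A′ holds verbatim:
an irreducible `ρ : Γ_ℚ → GL₂(ℚ̄₂)`, unramified a.e., de Rham at `2` with multiplicity-free labelled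
Hodge–Tate weights and reducible on `Γ_K` for a quadratic field `K`, has a Tate twist `ρ ⊗ ε₂^m`
attached away from `2N` to a newform `f ∈ S_k(Γ₁(N))`.  This is the landed
`cmTateTwistNewform_of_facts` with its glue hypothesis G supplied by
`exists_normTwist_inv_hasInfinityType_of_embExponent_ne`. [cite: Ribet1977Nebentypus, Thm. (3.4) and Cor. (3.5)]
[cite: Patrikis2019, Prop. 2.2.1, Lemma 2.2.4, Lemma 7.2.1] -/
theorem cmTateTwistNewform_of_literatureFacts : Literature.NumberTheory.PAdicHodge.isDeRhamFramed_of_isDeRhamFramed_induce → Literature.NumberTheory.GaloisRepresentations.FramedGaloisRep.exists_heckeCharacter_of_isDeRhamFramed → Literature.NumberTheory.PAdicHodge.labelledHodgeTateWeightsAt_induce_of_parallel → Literature.NumberTheory.EllipticCurves.ModularForms.Ribet1977_cmNewform_of_heckeCharacter → ∀ (ρ : Literature.NumberTheory.GaloisRepresentations.FramedGaloisRep ℚ (PadicAlgCl 2) 2), ρ.toGaloisRep.IsIrreducible → (∀ᶠ v : IsDedekindDomain.HeightOneSpectrum (NumberField.RingOfIntegers ℚ) in Filter.cofinite, ρ.IsUnramifiedAt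 v) → (∀ (v : IsDedekindDomain.HeightOneSpectrum (NumberField.RingOfIntegers ℚ)) (hv : ((2 : ℕ) : NumberField.RingOfIntegers ℚ) ∈ v.asIdeal), (Literature.NumberTheory.PAdicHodge.fontainePstAdicCompletion v 2 hv).IsDeRhamFramed (ρ.toLocal v) ∧ ∀ τ : v.adicCompletion ℚ →+* PadicAlgCl 2, Continuous τ → (ρ.labelledHodgeTateWeightsAt v (Literature.NumberTheory.PAdicHodge.fontainePstAdicCompletion v 2 hv).algebra (Literature.NumberTheory.PAdicHodge.fontainePstAdicCompletion v 2 hv).𝔅 τ).Nodup) → (∃ (K : Type) (_ : Field K) (_ : NumberField K), Module.finrank ℚ K = 2 ∧ ¬ (ρ.restrictField K).toGaloisRep.IsIrreducible) → ∃ (χ : Field.absoluteGaloisGroup ℚ →ₜ* (PadicAlgCl 2)ˣ) (m : ℤ), (∀ σ, χ σ = Literature.NumberTheory.GaloisRepresentations.cyclotomicPadicAlgCl ℚ 2 σ ^ m) ∧ ∃ (N : ℕ) (_ : NeZero N) (k : ℤ) (f : CuspForm (CongruenceSubgroup.Gamma1 N) k) (ιf : Literature.NumberTheory.EllipticCurves.ModularForms.coeffCharField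 f →+* PadicAlgCl 2), Literature.NumberTheory.EllipticCurves.ModularForms.IsNewform1 f ∧ Literature.NumberTheory.EllipticCurves.ModularForms.IsGaloisRepOfNewform1 f ιf {q | q ∣ N * 2} (Literature.NumberTheory.GaloisRepresentations.FramedRep.twist ρ χ) :=
  fun hF2' hF2 hH hF3 =>
    cmTateTwistNewform_of_facts hF2' hF2 hH hF3 exists_normTwist_inv_hasInfinityType_of_embExponent_ne

end Summit.Langlands.Langlands.Theorems.DyadicEisensteinFM

end
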